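import Literature.AlgebraicGeometry.AbelianSchemes.MFKClausesIsoTransport                      -- ★ `Polarization.exists_lam_eq_lamTransport` (universe 0)
import Literature.AlgebraicGeometry.AbelianSchemes.PolarizationUnitHypothesis                  -- ★ `Polarization.nonempty_unitHatSlice_iso`
import Literature.AlgebraicGeometry.AbelianSchemes.AbelianSchemeDualTransportOfBaseChange     -- ★ `DualPair.nonempty_unitHatSlice_baseChange_iso`
import Literature.AlgebraicGeometry.AbelianSchemes.LevelStructureTransportIso                  -- ★ `LevelStructure.exists_comp_of_iso`
import Literature.AlgebraicGeometry.AbelianSchemes.RingActionTransportAlongIso                 -- ★ (GS-1a) `RingAction.exists_transport_of_iso_comp`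
import Literature.AlgebraicGeometry.ModuliOfAbelianVarieties.SiegelAdmissibleOfIsoId          -- ★ `exists_iso_of_isBaseChangeVia_id`
import Literature.AlgebraicGeometry.AbelianSchemes.PolarizedAbelianSchemeWithLevelBaseChangeUnique -- ★ `IsBaseChangeVia.exists_isBaseChangeVia_id`
import Literature.AlgebraicGeometry.AbelianSchemes.AbelianSchemeOverLevelBaseChange            -- ★ `baseChange_isBaseChangeVia`
import Literature.AlgebraicGeometry.AbelianSchemes.AbelianSchemePolarizationBaseChange         -- ★ `DualPair.baseChange`
import Literature.AlgebraicGeometry.Limits.LocalizationRelativeGroupSpread                    -- ★ stage vocabulary `genOver` (§3)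
import HarnessLib

/-!
# TRANSPORT TO THE BASE CHANGE: the action, the level structure and the polarisation of a tuple `(A₁, ι₁, (Â₁, 𝒫₁), λ₁, φ₁)` whose abelian
# scheme IS a base change `𝒜 ×_Y T` (MFK Def. 7.2) move to `𝒜 ×_Y T` itself — the input of the spread organs (s1-ι)∕(s3)∕(s2-λ″)

Topic `AlgebraicGeometry/AbelianSchemes`; namespace `Literature.AlgebraicGeometry.AbelianSchemes.AbelianSchemeOver`.  THEOREMS ONLY (no definition,
no named fact, no instance, no notation, no `sorry`).  Cell hodgecm-mathlib (D-0151), P6 «MOD programme» (crux hLiu418 = stmt-HodgeConjecture-24832,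
`--supports`, count-neutral); organ «TRANSPORT PACKAGE» = step (3) of `F0/P6/B-p18/g39/CENSUS-stubGSPREAD-chain.v1.B-p18g39.md` for the L4 closer
leaf `Lines/F0_P6a_PELSpread.lean`, socket `stub_GSPREAD`, ROAD (S♭) (LEAD F0P6-plan (g3) «M-55»; desk F0P6a-plan (g4) memo §2).  After ★ (s1-A♭)
`exists_stage_of_generic_of_isOfRelDim_of_isProper_generic` has produced a stage abelian scheme `𝒜ₜ → P ⊗ D(t)` and a cartesian square
`h : A₁.IsBaseChangeVia 𝒜ₜ (P ◁ leg t) G` for the E-witness՚s abelian scheme `A₁` (moved to `P ⊗ Spec K`), the E-witness՚s ACTION, LEVEL STRUCTURE and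
POLARISATION must be read ON the canonical base change `𝒜ₜ ×_{P⊗D(t)} (P ⊗ Spec K) = 𝒜ₜ.baseChange (genOver t).hom` before ★ (s1-ι)
`exists_stage_ringAction`, ★ (s3) `LevelStructure.exists_stage_of_generic_overStage`, ★ (s2-λ″) `exists_stage_polarization_of_generic_polarization_of_isUnit_two''`
can spread them.  This file does exactly that, in ONE call.  HC_CM is proved only modulo the printed citations until rung 0 closes; nothing here
is about HC.

THE MATHEMATICS ([MumfordFogartyKirwan1994] Ch. 7 §2 Def. 7.2–7.3, [GortzWedhorn2020] Prop. 4.16: two base changes of `𝒜` along the same `f` are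
isomorphic AS GROUP SCHEMES over `T` by the comparison of the cartesian squares; [Kottwitz1992] §5: the action, [MFK94] Def. 7.1∕7.2: the level
sections and the polarisation, are transported along such an isomorphism).  Given `h : A₁.IsBaseChangeVia 𝒜 f G` and the canonical ★
`baseChange_isBaseChangeVia`, ★ `IsBaseChangeVia.exists_isBaseChangeVia_id` + ★ `exists_iso_of_isBaseChangeVia_id` give a group-scheme isomorphism
`e : A₁ ≅ 𝒜 ×_Y T` over `T` with `e ≫ pr₁ = G`; then ★ GS-1a `RingAction.exists_transport_of_iso_comp` (`ρ(a) = e⁻¹ ≫ ρ₁(a) ≫ e`), ★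
`LevelStructure.exists_comp_of_iso` (`σᵢ = σ₁ᵢ ≫ e`) and ★ `Polarization.exists_lam_eq_lamTransport` (`λ = e⁻¹ ≫ λ₁ ≫ Ĥ_e`, unit hypotheses from
★ `Polarization.nonempty_unitHatSlice_iso` on the reduced base and ★ `DualPair.nonempty_unitHatSlice_baseChange_iso` for the normalised stage dual
pair) transport the three structures; the target dual pair is THE base change `D ×_Y T` of any unit-normalised dual pair `D` of `𝒜`.

MAIN STATEMENTS.  §1 `exists_iso_baseChange_of_isBaseChangeVia` (the group-scheme isomorphism `A₁ ≅ 𝒜 ×_Y T` with `e ≫ pr₁ = G`);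
§2 **`exists_transport_baseChange_of_isBaseChangeVia`** (THE HEAD: `∃ e ρ φ pol, IsMonHom e.hom ∧ e.hom.left ≫ pr₁ = G ∧ (∀ a, e.hom ≫ ρ.i a = ρ₁.i a ≫ e.hom) ∧
(∀ i, φ.σ i = φ₁.σ i ≫ e.hom) ∧ pol.lam = lamTransport D₁ (D.baseChange f) e.symm e pol₁.lam`); §3 the ROAD (S♭) instance
**`exists_transport_genOver_of_isBaseChangeVia`** (`f :=` the cone map `P ◁ leg t`, outputs typed ON `𝒜ₜ.baseChange (genOver S K P t).hom`);
§4 (EDITION 2) **`exists_transport_baseChange_tupleRel_id_of_isBaseChangeVia`** — the transport comes WITH the six clauses along `𝟙 T` from the source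
tuple via `(e, Ĥ_e)`, over ANY reduced locally Noetherian `T` (★ `hat_isBaseChangeVia_id_hatTransport_of_isLocallyNoetherian_base`, no connectedness).

## References
* [MumfordFogartyKirwan1994] D. Mumford, J. Fogarty, F. Kirwan, *Geometric Invariant Theory*, 3rd ed. (1994), Ch. 7 §2 Def. 7.1–7.3 (pp. 129–130), Ch. 6 §2 (p. 121).
* [GortzWedhorn2020] U. Görtz, T. Wedhorn, *Algebraic Geometry I*, 2nd ed. (2020), Prop. 4.16 (p. 101), Section (4.7) (pp. 107–108).
* [Kottwitz1992] R. Kottwitz, *Points on some Shimura varieties over finite fields*, JAMS 5 (1992), §5 (p. 390).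
-/

set_option autoImplicit false

noncomputable section

-- Mathlib's `Over`/pull-back API is stated across semireducible wrappers (as in the ★ `AbelianSchemes/*` files).
set_option backward.isDefEq.respectTransparency false

open CategoryTheory CategoryTheory.Limits AlgebraicGeometry MonoidalCategory

namespace Literature.AlgebraicGeometry.AbelianSchemes

namespace AbelianSchemeOver

/-! ### §1 The group-scheme isomorphism `A₁ ≅ 𝒜 ×_Y T` of a cartesian square -/

section Iso

universe u

variable {Y T : Scheme.{u}} (𝒜 : AbelianSchemeOver Y) (f : T ⟶ Y) {A₁ : AbelianSchemeOver T} {G : A₁.X.left ⟶ 𝒜.X.left}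

/-- **A base change in the sense of MFK Def. 7.2 IS the chosen base change, up to a group-scheme isomorphism over `T` commuting with the
projections**: from `h : A₁.IsBaseChangeVia 𝒜 f G` an isomorphism `e : A₁ ≅ 𝒜 ×_Y T` in `Over T` with `IsMonHom e.hom` and `e ≫ pr₁ = G`
(★ `IsBaseChangeVia.exists_isBaseChangeVia_id` against ★ `baseChange_isBaseChangeVia`, then ★ `exists_iso_of_isBaseChangeVia_id`).
[cite: MumfordFogartyKirwan1994, Ch. 7 §2 Definition 7.2 (p. 129) and Definition 7.3 (p. 130)] [cite: GortzWedhorn2020, Prop. 4.16 (p. 101)] -/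
theorem exists_iso_baseChange_of_isBaseChangeVia (h : A₁.IsBaseChangeVia 𝒜 f G) :
    ∃ e : A₁.X ≅ (𝒜.baseChange f).X, IsMonHom e.hom ∧ e.hom.left ≫ pullback.fst 𝒜.X.hom f = G := by
  obtain ⟨H, -, hHG, hrel⟩ := (𝒜.baseChange_isBaseChangeVia f).exists_isBaseChangeVia_id h
  obtain ⟨e, he, heMon⟩ := exists_iso_of_isBaseChangeVia_id hrel
  exact ⟨e, heMon, by rw [he]; exact hHG⟩

end Iso

/-! ### §2 THE HEAD: action, level structure and polarisation move to `𝒜 ×_Y T` -/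

section Transport

-- UNIVERSE 0: ★ `Polarization.exists_lam_eq_lamTransport` (`MFKClausesIsoTransport`) is stated for `Scheme.{0}`; the consumer is universe 0.
variable {Y T : Scheme.{0}} [IsLocallyNoetherian T] [IsReduced T] (𝒜 : AbelianSchemeOver Y) (D : 𝒜.DualPair) (f : T ⟶ Y)
  {A₁ : AbelianSchemeOver T} {O : Type*} [CommRing O] (ρ₁ : RingAction O A₁) (D₁ : A₁.DualPair) (pol₁ : A₁.Polarization D₁)
  {g n : ℕ} (φ₁ : A₁.LevelStructure g n) {G : A₁.X.left ⟶ 𝒜.X.left}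

/-- **TRANSPORT TO THE BASE CHANGE** ([MumfordFogartyKirwan1994] Def. 7.1–7.3; [Kottwitz1992] §5).  Over a reduced locally Noetherian `T`, let
`(A₁, ρ₁, (Â₁, 𝒫₁), λ₁, φ₁)` be a tuple whose abelian scheme is a base change of `𝒜 → Y` along `f : T → Y` (`h : A₁.IsBaseChangeVia 𝒜 f G`), and let
`D = (Â, 𝒫)` be a dual pair of `𝒜` satisfying the unit hypothesis `𝒫|_{𝒜 × {ε}} ≅ 𝒪` (`hD`; e.g. `D := D₀.normalize`, ★ `nonempty_unitHatSlice_iso_normalize`).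
Then ON THE CHOSEN BASE CHANGE `𝒜 ×_Y T` (★ `AbelianSchemeOver.baseChange`) with the dual pair `D ×_Y T` (★ `DualPair.baseChange`) there are a ring
action `ρ`, a level structure `φ` and a polarisation `pol`, together with a group-scheme isomorphism `e : A₁ ≅ 𝒜 ×_Y T` over `T` (`e ≫ pr₁ = G`),
such that `e ≫ ρ(a) = ρ₁(a) ≫ e`, `φ.σᵢ = φ₁.σᵢ ≫ e`, and `pol.lam = lamTransport D₁ (D ×_Y T) e⁻¹ e λ₁` (★ `DualPair.lamTransport`: `e⁻¹ ≫ λ₁ ≫ Ĥ_e`).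
These are exactly the inputs of ★ (s1-ι) `exists_stage_ringAction`, ★ (s3) `LevelStructure.exists_stage_of_generic_overStage` and ★ (s2-λ″)
when `f` is the cone map of a stage (§3). [cite: MumfordFogartyKirwan1994, Ch. 7 §2 Definition 7.2 (p. 129) and Definition 7.3 (p. 130)]
[cite: MumfordFogartyKirwan1994, Ch. 6 §2 (p. 121)] [cite: Kottwitz1992, §5 (p. 390)] [cite: GortzWedhorn2020, Prop. 4.16 (p. 101)] -/
theorem exists_transport_baseChange_of_isBaseChangeVia (h : A₁.IsBaseChangeVia 𝒜 f G)
    (hD : Nonempty ((Scheme.Modules.pullback (DualPair.unitHatSlice D)).obj D.P ≅ SheafOfModules.unit _)) :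
    ∃ (e : A₁.X ≅ (𝒜.baseChange f).X) (_ : IsMonHom e.hom) (_ : IsMonHom e.symm.hom) (ρ : RingAction O (𝒜.baseChange f))
      (φ : (𝒜.baseChange f).LevelStructure g n) (pol : (𝒜.baseChange f).Polarization (D.baseChange f)),
      e.hom.left ≫ pullback.fst 𝒜.X.hom f = G ∧ (∀ a, e.hom ≫ ρ.i a = ρ₁.i a ≫ e.hom) ∧ (∀ i, φ.σ i = φ₁.σ i ≫ e.hom) ∧
        pol.lam = DualPair.lamTransport D₁ (D.baseChange f) e.symm e pol₁.lam := by
  obtain ⟨e, heMon, heG⟩ := exists_iso_baseChange_of_isBaseChangeVia 𝒜 f h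
  haveI := heMon
  haveI : IsMonHom e.symm.hom := (inferInstance : IsMonHom e.inv)
  -- the action
  obtain ⟨ρ, -, -, hρ, -⟩ := RingAction.exists_transport_of_iso_comp ρ₁ e
  -- the level structure
  obtain ⟨φ, hφ⟩ := LevelStructure.exists_comp_of_iso e φ₁
  -- the polarisation (unit hypotheses: `pol₁` over the reduced `T`; `D ×_Y T` from `hD`)
  obtain ⟨pol, hpol⟩ := Polarization.exists_lam_eq_lamTransport D₁ (D.baseChange f) e.symm e rfl pol₁.nonempty_unitHatSlice_iso
    (D.nonempty_unitHatSlice_baseChange_iso hD) pol₁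
  exact ⟨e, heMon, inferInstance, ρ, φ, pol, heG, hρ, hφ, hpol⟩

end Transport

/-! ### §3 The ROAD (S♭) instance: transport to `𝒜ₜ ×_{P⊗D(t)} (P ⊗ Spec K)` — the inputs of (s1-ι)∕(s3)∕(s2-λ″) -/

section Stage

open Literature.AlgebraicGeometry.Motives (SchemeOver specOver)
open Literature.AlgebraicGeometry.Limits.LocApprox (Idx baseDiagram baseCone leg genOver)

variable {A : Type} [CommRing A] (S : Submonoid A) (K : Type) [CommRing K] [Algebra A K] [IsLocalization S K] (P : SchemeOver A)
  (t : Idx S) [IsLocallyNoetherian (genOver S K P t).left] [IsReduced (genOver S K P t).left]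
  (𝒜 : AbelianSchemeOver (P ⊗ (baseDiagram S).obj t).left) (D : 𝒜.DualPair)
  {A₁ : AbelianSchemeOver (genOver S K P t).left} {O : Type*} [CommRing O] (ρ₁ : RingAction O A₁) (D₁ : A₁.DualPair)
  (pol₁ : A₁.Polarization D₁) {g n : ℕ} (φ₁ : A₁.LevelStructure g n) {G : A₁.X.left ⟶ 𝒜.X.left}

/-- **ROAD (S♭), the inputs of the spread organs in ONE call.**  After ★ (s1-A♭) `exists_stage_of_generic_of_isOfRelDim_of_isProper_generic`
(`h : A₁.IsBaseChangeVia 𝒜ₜ (P ◁ leg t).left G` for the E-witness՚s abelian scheme `A₁` moved to the generic base `P ⊗ Spec K`, ★ `genOver`) and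
any unit-normalised dual pair `D` of `𝒜ₜ` (`dualPairOf …` then ★ `DualPair.normalize`): the E-witness՚s action `ρ₁`, level structure `φ₁` and
polarisation `pol₁` transported to `𝒜ₜ.baseChange (genOver S K P t).hom` with the dual pair `D.baseChange (genOver S K P t).hom` — the `ρ` of ★
`exists_stage_ringAction`, the level structure of ★ `LevelStructure.exists_stage_of_generic_overStage`, the polarisation of ★ (s2-λ″) — along a
group-scheme isomorphism `e : A₁ ≅ 𝒜ₜ ×_{P⊗D(t)} (P ⊗ Spec K)` with `e ≫ pr₁ = G`. [cite: MumfordFogartyKirwan1994, Ch. 7 §2 Definition 7.2 (p. 129) and Definition 7.3 (p. 130)]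
[cite: Kottwitz1992, §5 (p. 390)] [cite: GortzWedhorn2020, Prop. 4.16 (p. 101)] -/
theorem exists_transport_genOver_of_isBaseChangeVia (h : A₁.IsBaseChangeVia 𝒜 (P ◁ (baseCone S K).π.app t).left G)
    (hD : Nonempty ((Scheme.Modules.pullback (DualPair.unitHatSlice D)).obj D.P ≅ SheafOfModules.unit _)) :
    ∃ (e : A₁.X ≅ (𝒜.baseChange (genOver S K P t).hom).X) (_ : IsMonHom e.hom) (_ : IsMonHom e.symm.hom)
      (ρ : RingAction O (𝒜.baseChange (genOver S K P t).hom)) (φ : (𝒜.baseChange (genOver S K P t).hom).LevelStructure g n)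
      (pol : (𝒜.baseChange (genOver S K P t).hom).Polarization (D.baseChange (genOver S K P t).hom)),
      e.hom.left ≫ pullback.fst 𝒜.X.hom (genOver S K P t).hom = G ∧ (∀ a, e.hom ≫ ρ.i a = ρ₁.i a ≫ e.hom) ∧ (∀ i, φ.σ i = φ₁.σ i ≫ e.hom) ∧
        pol.lam = DualPair.lamTransport D₁ (D.baseChange (genOver S K P t).hom) e.symm e pol₁.lam :=
  exists_transport_baseChange_of_isBaseChangeVia 𝒜 D (genOver S K P t).hom ρ₁ D₁ pol₁ φ₁ h hD

end Stage

/-! ### §4 (EDITION 2) THE TRANSPORT IS AN ISOMORPHISM OF TUPLES: the six clauses along `𝟙 T` from `(A₁, ρ₁, Â₁, 𝒫₁, λ₁, φ₁)` to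
`(𝒜 ×_Y T, ρ, Â ×_Y T, 𝒫_T, λ, φ)` via `(e, Ĥ_e)` — over ANY reduced locally Noetherian `T` (no connectedness) -/

section SixClauses

variable {Y T : Scheme.{0}} [IsLocallyNoetherian T] [IsReduced T] (𝒜 : AbelianSchemeOver Y) (D : 𝒜.DualPair) (f : T ⟶ Y)
  {A₁ : AbelianSchemeOver T} {O : Type*} [CommRing O] (ρ₁ : RingAction O A₁) (D₁ : A₁.DualPair) (pol₁ : A₁.Polarization D₁)
  {g n : ℕ} (φ₁ : A₁.LevelStructure g n) {G : A₁.X.left ⟶ 𝒜.X.left}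

/-- **THE TRANSPORTED TUPLE IS ISOMORPHIC TO THE SOURCE TUPLE AS A TUPLE** ([MumfordFogartyKirwan1994] Def. 7.2–7.3: «isomorphism of triples»,
with the `𝒪`-action of [Kottwitz1992] §5).  In the situation of §2, the transported structures `(ρ, φ, pol)` on `𝒜 ×_Y T` come WITH the six
clauses along `𝟙 T` from `(A₁, ρ₁, (Â₁, 𝒫₁), λ₁, φ₁)` to `(𝒜 ×_Y T, ρ, (Â ×_Y T, 𝒫_T), pol.lam, φ)` via `(e, Ĥ_e)` (`Ĥ_e =` ★ `DualPair.hatTransport`): level ∕ `X`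
(★ `levelStructure_isBaseChangeVia_id_of_isMonHom`), `X̂` (★ `hat_isBaseChangeVia_id_hatTransport_of_isLocallyNoetherian_base` — ANY locally Noetherian base,
unit hypotheses from ★ `Polarization.nonempty_unitHatSlice_iso` ∕ ★ `nonempty_unitHatSlice_baseChange_iso`), Poincaré (★ `nonempty_pullback_map_hatTransport_iso`),
`λ` (the defining equation `λ = e⁻¹ ≫ λ₁ ≫ Ĥ_e` of ★ `lamTransport`), `𝒪` (GS-1a).  So the E′-tuple and the tuple handed to the spread organs are the SAME
point of the moduli problem over the generic base — the first link of the generic reading of `stub_GSPREAD` (chain step (5)); no connectedness of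
`T` is used (the generic fibre of a Shimura curve need not be connected). [cite: MumfordFogartyKirwan1994, Ch. 7 §2 Definition 7.2 (p. 129) and Definition 7.3 (p. 130)]
[cite: MumfordFogartyKirwan1994, Ch. 6 §1 Corollary 6.4 (p. 117)] [cite: Kottwitz1992, §5 (p. 390)] -/
theorem exists_transport_baseChange_tupleRel_id_of_isBaseChangeVia (h : A₁.IsBaseChangeVia 𝒜 f G)
    (hD : Nonempty ((Scheme.Modules.pullback (DualPair.unitHatSlice D)).obj D.P ≅ SheafOfModules.unit _)) :
    ∃ (e : A₁.X ≅ (𝒜.baseChange f).X) (_ : IsMonHom e.hom) (ρ : RingAction O (𝒜.baseChange f))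
      (φ : (𝒜.baseChange f).LevelStructure g n) (pol : (𝒜.baseChange f).Polarization (D.baseChange f)),
      e.hom.left ≫ pullback.fst 𝒜.X.hom f = G ∧
      (φ₁.IsBaseChangeVia φ (𝟙 T) e.hom.left ∧
        D₁.hat.IsBaseChangeVia (D.baseChange f).hat (𝟙 T) (DualPair.hatTransport (D.baseChange f) D₁ e) ∧
        (∃ (wG : A₁.X.hom ≫ 𝟙 T = e.hom.left ≫ (𝒜.baseChange f).X.hom)
            (wĜ : D₁.hat.X.hom ≫ 𝟙 T = DualPair.hatTransport (D.baseChange f) D₁ e ≫ (D.baseChange f).hat.X.hom),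
          Nonempty ((Scheme.Modules.pullback
            (pullback.map A₁.X.hom D₁.hat.X.hom (𝒜.baseChange f).X.hom (D.baseChange f).hat.X.hom e.hom.left
              (DualPair.hatTransport (D.baseChange f) D₁ e) (𝟙 T) wG wĜ)).obj (D.baseChange f).P ≅ D₁.P)) ∧
        pol₁.lam.left ≫ DualPair.hatTransport (D.baseChange f) D₁ e = e.hom.left ≫ pol.lam.left ∧
        ∀ a : O, (ρ₁.i a).left ≫ e.hom.left = e.hom.left ≫ (ρ.i a).left) := by
  obtain ⟨e, heMon, heMon', ρ, φ, pol, heG, hρ, hφ, hpol⟩ :=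
    exists_transport_baseChange_of_isBaseChangeVia 𝒜 D f ρ₁ D₁ pol₁ φ₁ h hD
  haveI := heMon
  haveI := heMon'
  have hD₁ := pol₁.nonempty_unitHatSlice_iso
  have hD' := D.nonempty_unitHatSlice_baseChange_iso (g := f) hD
  refine ⟨e, heMon, ρ, φ, pol, heG, levelStructure_isBaseChangeVia_id_of_isMonHom φ₁ φ e.hom (fun i => (hφ i).symm),
    DualPair.hat_isBaseChangeVia_id_hatTransport_of_isLocallyNoetherian_base (D.baseChange f) D₁ e e.symm rfl hD' hD₁,
    ⟨by rw [Category.comp_id, Over.w e.hom], by rw [Category.comp_id, DualPair.hatTransport_comp_hom],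
      DualPair.nonempty_pullback_map_hatTransport_iso (D.baseChange f) D₁ e⟩, ?_, fun a => ?_⟩
  · -- `λ`: `pol.lam = e⁻¹ ≫ λ₁ ≫ Ĥ_e`, so `e ≫ pol.lam = λ₁ ≫ Ĥ_e`
    have h1 : e.hom ≫ pol.lam = pol₁.lam ≫ DualPair.hatTransportOver (D.baseChange f) D₁ e := by
      rw [hpol, DualPair.lamTransport, Iso.symm_hom, Iso.hom_inv_id_assoc]
    rw [← DualPair.hatTransportOver_left, ← Over.comp_left, ← Over.comp_left, h1]
  · rw [← Over.comp_left, ← Over.comp_left, hρ a]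

end SixClauses

end AbelianSchemeOver

end Literature.AlgebraicGeometry.AbelianSchemes

end
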